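import Literature.Analysis.FluidPDE.FluidComputer.GalerkinEnergyBalance
import Literature.Analysis.FluidPDE.FluidComputer.Dealiasing
import HarnessLib

/-!
# Half-spectrum (real-to-complex) bookkeeping: on a symmetric mode set a Hermitian-even lattice sum is the `k₃ = 0` plane once plus TWICE the open half `k₃ > 0`

PLACEMENT: cell-own elementary bookkeeping lemmas of `pub-fluidc` (topic `FluidComputer` under the host summit; the
vocabulary `FourierVelocity`, `modalEnergy`, `truncEnergy`, `truncEnstrophy`, `knormSq`, `Dealiasing.box` is the
Literature one, opened below).

HONEST FRAMING (cell `pub-fluidc`, verbatim): *low prior, high value-of-information experiment on Tao's machine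
paradigm; NOT a claim that NS blows up.* Nothing here is about the Navier–Stokes PDE. A pseudo-spectral code for a
REAL field stores only half of its Fourier coefficients — the real-to-complex layout `[N, N, N/2+1]` along the last
axis (HOME/pub-fluidc-p1/code/p1ns/p1spec.py `Box`: `jh = 0 … N/2`, Parseval weights `wpar = (1, 2, …, 2, 1)`;
HOME/paper/sec-p1spec.md §P.2 'Parseval weights 1/2/1 on the half-spectrum planes') — because the coefficients of a
real function satisfy `û(−k) = conj û(k)` [cite: CanutoEtAl2007, §8.1 (after (8.1.5))] (the `reality` field of the
tree's `ShellTransfer.FourierVelocity`). Every quadratic diagnostic such a code prints (`E`, `Z`, band energies,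
shell spectra) is a sum over the FULL symmetric mode set `S = −S` of a weight that is even under `k ↦ −k`; computed
from the stored half it must count the `k₃ = 0` plane once and the planes `k₃ > 0` twice. PROVED (0 sorry, no named
facts) [folklore: Parseval for the half-complex DFT layout]:

* `sum_symm_eq_plane_add_two_mul_half` — for `S = −S` and ANY even weight `w(−k) = w(k)`:
  **`Σ_{k∈S} w(k) = Σ_{k∈S, k₃=0} w(k) + 2 Σ_{k∈S, k₃>0} w(k)`** (the involution `k ↦ −k` maps the open lower half
  onto the open upper half);
* `E(−k) = E(k)` (from `reality`), hence `truncEnergy_eq_plane_add_two_mul_half`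
  (`E_S = Σ_{k₃=0} E(k) + 2Σ_{k₃>0} E(k)`) and `truncEnstrophy_eq_plane_add_two_mul_half` (same with `|k|²E(k)`);
  `plane_add_half_le_sum` (dropping the factor 2 under-counts);
  `sum_filter_symm_eq_plane_add_two_mul_half` — the same for any band / shell `S ∩ {P(|k|²)}` (a predicate of `|k|²`
  keeps the symmetry), i.e. for every band energy and every shell of a spectrum;
* `two_mul_abs_lt_of_mem_box` — on the cubic truncation `|k_i| ≤ K` with `2K < N` no retained index is a Nyquist
  index (`2|k_i| < N`, whereas `k_i ≡ −k_i (mod N)` with `k_i ≠ 0` needs `2|k_i| = N`): the trailing weight `1` of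
  `wpar` (the self-conjugate plane `j₃ = N/2`, `N` even) multiplies an EMPTY plane of the 2/3-truncated state
  (`K < N/3 < N/2`), so on the retained set the weights are exactly `(1, 2)`. Getting this weight wrong is the classic
  factor-2 error of half-spectrum Parseval sums; the A0 pins of §P.2 (E, Z, band energies of a handed-over field
  reproduced to the source's printed digits) are the cell's empirical check of exactly this bookkeeping.
-/

noncomputable section

namespace Summit.NavierStokesRegularity.FluidComputer

open Complex ComplexConjugate Finset
open scoped BigOperators
open Literature.Analysis.FluidPDE.FluidComputer
open Literature.Analysis.FluidPDE.FluidComputer.ShellTransfer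

namespace HalfSpectrumWeights

/-- **Half-spectrum Parseval weights.** On a mode set closed under `k ↦ −k`, the sum of any weight that is even
under `k ↦ −k` equals the `k₃ = 0` plane counted once plus the open half `k₃ > 0` counted twice.
[folklore: Parseval in the real-to-complex (half-complex) layout] -/
theorem sum_symm_eq_plane_add_two_mul_half (S : Finset (Fin 3 → ℤ)) (hK : ∀ k ∈ S, -k ∈ S)
    (w : (Fin 3 → ℤ) → ℝ) (hw : ∀ k, w (-k) = w k) :
    ∑ k ∈ S, w k = ∑ k ∈ S.filter (fun k => k 2 = 0), w k + 2 * ∑ k ∈ S.filter (fun k => 0 < k 2), w k := by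
  classical
  -- three-way split of `S` by the sign of the last index
  have h1 := Finset.sum_filter_add_sum_filter_not S (fun k => k 2 = 0) w
  have h2 := Finset.sum_filter_add_sum_filter_not (S.filter fun k => ¬ k 2 = 0) (fun k => 0 < k 2) w
  rw [Finset.filter_filter, Finset.filter_filter] at h2
  have hpos : S.filter (fun k => ¬ k 2 = 0 ∧ 0 < k 2) = S.filter (fun k => 0 < k 2) := by
    refine Finset.filter_congr fun k _ => ⟨fun h => h.2, fun h => ⟨ne_of_gt h, h⟩⟩
  have hneg : S.filter (fun k => ¬ k 2 = 0 ∧ ¬ 0 < k 2) = S.filter (fun k => k 2 < 0) := by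
    refine Finset.filter_congr fun k _ => ⟨fun h => lt_of_le_of_ne (not_lt.mp h.2) h.1, fun h => ⟨ne_of_lt h, ?_⟩⟩
    exact not_lt.mpr h.le
  rw [hpos, hneg] at h2
  -- the involution `k ↦ -k` maps the lower open half onto the upper open half, preserving `w`
  have hbij : ∑ k ∈ S.filter (fun k => k 2 < 0), w k = ∑ k ∈ S.filter (fun k => 0 < k 2), w k := by
    refine Finset.sum_nbij' (fun k => -k) (fun k => -k) ?_ ?_ ?_ ?_ ?_
    · intro k hk
      rw [Finset.mem_filter] at hk ⊢
      exact ⟨hK k hk.1, by simpa using hk.2⟩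
    · intro k hk
      rw [Finset.mem_filter] at hk ⊢
      exact ⟨hK k hk.1, by simpa using hk.2⟩
    · intro k _; simp
    · intro k _; simp
    · intro k _; rw [hw]
  linarith

/-- The same on any sub-band cut out by a predicate of `|k|²` (bands, shells of a spectrum): the cut keeps the
symmetry `k ↦ −k`, so band energies and shell spectra obey the same `(1, 2)` weights. [folklore] -/
theorem sum_filter_symm_eq_plane_add_two_mul_half (S : Finset (Fin 3 → ℤ)) (hK : ∀ k ∈ S, -k ∈ S)
    (P : ℝ → Prop) [DecidablePred P] (w : (Fin 3 → ℤ) → ℝ) (hw : ∀ k, w (-k) = w k) :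
    ∑ k ∈ S.filter (fun k => P (knormSq k)), w k =
      ∑ k ∈ (S.filter (fun k => P (knormSq k))).filter (fun k => k 2 = 0), w k
        + 2 * ∑ k ∈ (S.filter (fun k => P (knormSq k))).filter (fun k => 0 < k 2), w k := by
  refine sum_symm_eq_plane_add_two_mul_half _ (fun k hk => ?_) w hw
  rw [Finset.mem_filter] at hk ⊢
  refine ⟨hK k hk.1, ?_⟩
  have : knormSq (-k) = knormSq k := by unfold knormSq; simp
  rw [this]; exact hk.2

/-- **The energy from the stored half**: `E_S = Σ_{k∈S, k₃=0} E(k) + 2 Σ_{k∈S, k₃>0} E(k)` for `S = −S`; the modal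
energy is even under `k ↦ −k` by the reality condition `û(−k) = conj û(k)` [cite: CanutoEtAl2007, §8.1 (after (8.1.5))]
(the evenness is `ChiralScrewGroupEnantiomorph.modalEnergy_neg` elsewhere in this directory; re-derived inline here
to keep the imports light). [folklore] -/
theorem truncEnergy_eq_plane_add_two_mul_half (U : FourierVelocity) (S : Finset (Fin 3 → ℤ))
    (hK : ∀ k ∈ S, -k ∈ S) :
    truncEnergy U S = ∑ k ∈ S.filter (fun k => k 2 = 0), modalEnergy U k
      + 2 * ∑ k ∈ S.filter (fun k => 0 < k 2), modalEnergy U k := by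
  refine sum_symm_eq_plane_add_two_mul_half S hK (modalEnergy U) fun k => ?_
  unfold modalEnergy
  congr 1
  exact Finset.sum_congr rfl fun j _ => by rw [U.reality, Complex.normSq_conj]

/-- **The enstrophy from the stored half**: `Z_S = Σ_{k₃=0} |k|²E(k) + 2 Σ_{k₃>0} |k|²E(k)` for `S = −S`.
[folklore] -/
theorem truncEnstrophy_eq_plane_add_two_mul_half (U : FourierVelocity) (S : Finset (Fin 3 → ℤ))
    (hK : ∀ k ∈ S, -k ∈ S) :
    truncEnstrophy U S = ∑ k ∈ S.filter (fun k => k 2 = 0), knormSq k * modalEnergy U k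
      + 2 * ∑ k ∈ S.filter (fun k => 0 < k 2), knormSq k * modalEnergy U k := by
  refine sum_symm_eq_plane_add_two_mul_half S hK (fun k => knormSq k * modalEnergy U k) fun k => ?_
  have hk : knormSq (-k) = knormSq k := by unfold knormSq; simp
  have hE : modalEnergy U (-k) = modalEnergy U k := by
    unfold modalEnergy
    congr 1
    exact Finset.sum_congr rfl fun j _ => by rw [U.reality, Complex.normSq_conj]
  simp only [hk, hE]

/-- Dropping the factor `2` UNDER-counts: for a nonnegative even weight the half-spectrum sum with weights `(1, 1)`
is at most the true sum, with equality only if the open half carries nothing. [folklore] -/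
theorem plane_add_half_le_sum (S : Finset (Fin 3 → ℤ)) (hK : ∀ k ∈ S, -k ∈ S)
    (w : (Fin 3 → ℤ) → ℝ) (hw : ∀ k, w (-k) = w k) (hw0 : ∀ k, 0 ≤ w k) :
    ∑ k ∈ S.filter (fun k => k 2 = 0), w k + ∑ k ∈ S.filter (fun k => 0 < k 2), w k ≤ ∑ k ∈ S, w k := by
  rw [sum_symm_eq_plane_add_two_mul_half S hK w hw]
  have : 0 ≤ ∑ k ∈ S.filter (fun k => 0 < k 2), w k := Finset.sum_nonneg fun k _ => hw0 k
  linarith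

/-- **No Nyquist index on the truncated lattice.** On the cubic truncation `|k_i| ≤ K` with `2K < N`, every
retained index has `2|k_i| < N`; a self-conjugate nonzero index of the length-`N` DFT (`k_i ≡ −k_i (mod N)`, i.e.
the plane `j = N/2`, `N` even, which the half-complex layout stores with weight `1`) needs `2|k_i| = N`. So on the
2/3-truncated state (`K < N/3`) that plane is empty and the weights on the retained set are exactly `(1, 2)`.
[folklore] -/
theorem two_mul_abs_lt_of_mem_box {K N : ℕ} (hKN : 2 * K < N) {k : Fin 3 → ℤ} (hk : k ∈ Dealiasing.box K)
    (i : Fin 3) : 2 * |k i| < (N : ℤ) := by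
  have hi := (Dealiasing.mem_box.mp hk) i
  have : (2 * K : ℤ) < (N : ℤ) := by exact_mod_cast hKN
  linarith

/-- In particular a retained index is never congruent to its negative modulo `N` unless it is zero: for
`k ∈ box K`, `2K < N`, and `k_i ≠ 0`, `N` does not divide `2 k_i`. [folklore] -/
theorem not_dvd_two_mul_of_mem_box {K N : ℕ} (hKN : 2 * K < N) {k : Fin 3 → ℤ} (hk : k ∈ Dealiasing.box K)
    (i : Fin 3) (hki : k i ≠ 0) : ¬ ((N : ℤ) ∣ 2 * k i) := by
  intro hd
  have hlt := two_mul_abs_lt_of_mem_box hKN hk i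
  rcases hd with ⟨c, hc⟩
  have hN : (0 : ℤ) < N := by
    have : (0 : ℤ) ≤ 2 * |k i| := by positivity
    linarith
  -- |2 k_i| = N |c| < N forces c = 0, hence k_i = 0
  have habs : 2 * |k i| = (N : ℤ) * |c| := by
    have := congrArg (fun z : ℤ => |z|) hc
    simpa [abs_mul, abs_of_pos hN] using this
  have hc0 : |c| < 1 := by
    by_contra h
    have h1 : 1 ≤ |c| := not_lt.mp h
    have : (N : ℤ) ≤ (N : ℤ) * |c| := by nlinarith
    linarith
  have : c = 0 := by
    have : |c| = 0 := by
      have h0 : 0 ≤ |c| := abs_nonneg c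
      omega
    exact abs_eq_zero.mp this
  subst this
  simp at hc
  exact hki hc

end HalfSpectrumWeights

end Summit.NavierStokesRegularity.FluidComputer

end
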